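import Mathlib
import HarnessLib
import Summits.CriticalPhenomena.PercolationContinuityZ3.Theses.PercLowPointHalfSpace
import Summits.CriticalPhenomena.PercolationContinuityZ3.Theorems.PercLowPointHalfSpaceLowPointBookkeepingLevelCount
import Summits.CriticalPhenomena.PercolationContinuityZ3.Theorems.PercLowPointHalfSpaceLowPointBookkeepingCubeExit
import Summits.CriticalPhenomena.PercolationContinuityZ3.Theorems.PercLowPointHalfSpaceLowPointBookkeepingStemDyadic
import Summits.CriticalPhenomena.PercolationContinuityZ3.Theorems.PercLowPointHalfSpaceLowPointBookkeepingStemComposition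
import Summits.CriticalPhenomena.PercolationContinuityZ3.Theorems.PercLowPointHalfSpaceLowPointBookkeepingStemLevel

/-!
# Skeleton `stem-criterion` for the crux `LowPointBookkeeping` (stmt-CriticalPhenomena-14713) — lead a1

Line `SketchIdeator4` (card `cube-exit-stem-criterion`, crux-ideate round 2, ideator 4), reshaped into the
registered form by lead a1 (2026-08-17).  K = `A → B → C → [P_{p_c}(0 ↔ n e₀) → 0]`.

Objects (bond percolation on `ℤ³`, `P = P_{p_c}`, `ℍ = {x₀ ≥ 0}`, `U = C_ℍ(0)`), all written inline over
existing declarations (no new definitions):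
* apex `x* = r e₀ = Pi.single 0 r`, cube `Q_r(x*) = {y | ∀ i, |y i - x* i| ≤ r}` (lies in `ℍ`, bottom face
  on the floor `∂ℍ`), LOCALISED point-to-wall event `W_r = {x* ↔ ∂ℍ inside Q_r(x*)}`;
* `arm_R = {U reaches sup-distance ≥ R}` — the route's arm event verbatim (as in `QuantitativeBGN`);
* local footprint `locFoot_R(ω) = #{g ∈ B_R ∩ ∂ℍ | 0 ↔ g inside B_R ∩ ℍ}` (a `Finset.filter` cardinality),
  thin-stem event `thin_R^φ = {locFoot_R < (2R)^φ}`;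
* level boxes `{x ∈ B_n | x₀ = r}`, in-box masses `Σ_{x ∈ B_n} P(0 ↔_ℍ x, …)`.

Stubs (sorries live ONLY in `stub_*`):
* LEMMAS (provable now): `stub_cubeExit` (θ(p) ≤ 6·P_p(W_r), every p, r: six faces + cube symmetry),
  `stub_stemLevel` (THE lemma of the line, every p: `P_p(W_r) ≤ t⁻¹ E|U ∩ L_r ∩ B_{2r}| + E[|U ∩ L_r ∩ B_r|;
  locFoot_r < t]`, footprint-normalised horizontal mass transport + re-rooting at a thin exit foot),
  `stub_dyadic` (sum the levels `r ∈ [R, 2R)`: the dyadic stem criterion), `stub_composition`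
  (`Bwide → QuantC a → StemLight φ → a + φ > 7/4 → θ(p_c) = 0`, real analysis);
* HYPOTHESIS-STUBS (route-level inputs, NOT lemmas from A, B, C — the card's restatement R6):
  `stub_bwide_of_B` (B re-typed on the 4×-ball) and `stub_stemInputs`
  (`∃ a φ, 0 ≤ φ ∧ 7/4 < a + φ ∧ (C → QuantC a) ∧ StemLight φ`, the weakest form of "C with a named exponent +
  thin-stemmed tall wall clusters carry vanishing level density").
Composition `LowPointBookkeeping_of`: A idle; B enters through `stub_bwide_of_B`, C through `stub_stemInputs`;
`θ(p_c) = 0 ⇒` axis decay by the landed `LowPoint.tendsto_real_openConn_axis_of_percolationContinuityZ3`.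
-/

noncomputable section

open MeasureTheory Filter Topology
open Literature.Probability.Percolation Literature.Probability.LatticeModels
open scoped ENNReal Classical

namespace Summit.CriticalPhenomena.PercolationContinuityZ3.Theorems.StemCriterion

open Summit.CriticalPhenomena.PercolationContinuityZ3.Theses.PercLowPointHalfSpace

/-! ## Registered stubs — lemmas: ALL LANDED (imported)

`stub_cubeExit` (…LowPointBookkeepingCubeExit, p146516), `stub_stemLevel` (…StemTransport p146929, …StemLevelTransports,
…StemLevel), `stub_dyadic` (…StemDyadic, p146713), `stub_composition` (…StemComposition, p146607).  The only sorries
left are the two HYPOTHESIS-stubs below (route-level inputs). -/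

/-! ## Registered stubs — hypotheses (route-level inputs; NOT lemmas from A, B, C) -/

/-- **stub_bwide_of_B** (HYPOTHESIS-STUB, transfer of B): the route's `TallClusterMassBound` (B, matched scale:
mass of `U ∩ B_r` on `arm_r`) re-typed on the WIDE ball — `Σ_{x ∈ B_{4r}} P(0 ↔_ℍ x, arm_r) ≤ C r^{11/4} P(arm_r)`.
Same exponent and sources as B (card: "Bwide is a re-typing of B"); the implication is not formal (on
`arm_r ∖ arm_{4r}` B bounds only `|U ∩ B_r|`), so this is an input of restatement R6, not a lemma. -/
theorem stub_bwide_of_B : TallClusterMassBound → (∃ C : ℝ, ∀ r : ℕ, 1 ≤ r → ∑ x ∈ box 3 (4 * r), (bondPercolation (zdGraph 3) (criticalProbI 3)).real (openConnIn {x : Site 3 | 0 ≤ x 0} 0 x ∩ {ω | ∃ y : Site 3, (∃ i : Fin 3, (r : ℤ) ≤ |y i|) ∧ ω ∈ openConnIn {x : Site 3 | 0 ≤ x 0} 0 y}) ≤ C * (r : ℝ) ^ ((11 : ℝ) / 4) * (bondPercolation (zdGraph 3) (criticalProbI 3)).real {ω | ∃ y : Site 3, (∃ i : Fin 3, (r :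 ℤ) ≤ |y i|) ∧ ω ∈ openConnIn {x : Site 3 | 0 ≤ x 0} 0 y}) := by
  sorry

/-- **stub_stemInputs** (HYPOTHESIS-STUB, the open content of restatement R6 in its weakest form): there are
`a`, `φ ≥ 0` with `a + φ > 7/4` such that the route's `QuantitativeBGN` (C: `∃ a > 0`) yields `QuantC a` (C with
the NAMED exponent `a`) and `StemLight φ` holds:
`R⁻¹ · Σ_{x ∈ B_{2R}} P(0 ↔_ℍ x, arm_R, locFoot_R < (2R)^φ) → 0`.
Real world: `a ≤ x_s ≈ 0.975` forces `φ > 0.775`; the card's MC (kit j023346, `R ≤ 32`) has the thin term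
increasing for every `φ ≥ 0.75` — numerically adverse. -/
theorem stub_stemInputs : ∃ a φ : ℝ, 0 ≤ φ ∧ (7 : ℝ) / 4 < a + φ ∧ (QuantitativeBGN → (∃ C : ℝ, ∀ r : ℕ, 1 ≤ r → (bondPercolation (zdGraph 3) (criticalProbI 3)).real {ω | ∃ y : Site 3, (∃ i : Fin 3, (r : ℤ) ≤ |y i|) ∧ ω ∈ openConnIn {x : Site 3 | 0 ≤ x 0} 0 y} ≤ C * (r : ℝ) ^ (-a))) ∧ Tendsto (fun R : ℕ => (R : ℝ)⁻¹ * ∑ x ∈ box 3 (2 * R), (bondPercolation (zdGraph 3) (criticalProbI 3)).real (openConnIn {x : Site 3 | 0 ≤ x 0} 0 x ∩ {ω | ∃ y : Site 3, (∃ i : Fin 3, (R : ℤ) ≤ |y i|) ∧ ω ∈ openConnIn {x : Site 3 | 0 ≤ x 0} 0 y} ∩ {ω | ((((box 3 R).filter fun g : Site 3 => g 0 = 0 ∧ ω ∈ openConnIn ((↑(box 3 R) : Set (Site 3)) ∩ {x : Site 3 | 0 ≤ x 0}) 0 g).card : ℕ) : ℝ) < (2 * (R : ℝ)) ^ φ}))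 atTop (𝓝 0) := by
  sorry

/-! ## Composition (glue only) -/

/-- **`θ(p_c(ℤ³)) = 0` from the stubs**: pick `(a, φ)` from `stub_stemInputs`, run the dyadic stem criterion
(`stub_dyadic` fed by `stub_cubeExit` and `stub_stemLevel` at `p_c`) through `stub_composition` with
`Bwide` (from B) and `QuantC a` (from C). -/
theorem theta_eq_zero_of_stubs (hB : TallClusterMassBound) (hC : QuantitativeBGN) :
    theta (zdGraph 3) (0 : Site 3) (criticalProbI 3) = 0 := by
  obtain ⟨a, φ, hφ, haφ, hCq, hS⟩ := stub_stemInputs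
  exact stub_composition a φ hφ haφ
    (stub_dyadic (fun r => stub_cubeExit (criticalProbI 3) r)
      (fun r hr t ht => stub_stemLevel (criticalProbI 3) r hr t ht) φ hφ)
    (stub_bwide_of_B hB) (hCq hC) hS

/-- **Composition: the crux `LowPointBookkeeping` from the stubs** (A idle; `θ(p_c) = 0 ⇒` axis decay by the
landed `LowPoint.tendsto_real_openConn_axis_of_percolationContinuityZ3`). -/
theorem LowPointBookkeeping_of : LowPointBookkeeping := by
  intro _hA hB hC
  exact LowPoint.tendsto_real_openConn_axis_of_percolationContinuityZ3 (theta_eq_zero_of_stubs hB hC)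

end Summit.CriticalPhenomena.PercolationContinuityZ3.Theorems.StemCriterion

end
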